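import Mathlib
import Summits.QuantumFields.YangMills.Theorems.EguchiKawaiDirectionLadderHaarWeightedColumn
import HarnessLib

/-!
# Weighted nested-pattern small-ball bound for the columns of a Haar unitary

The MULTISCALE engine (route `EguchiKawaiDirectionLadder`, crux `TripleSmallBallMargin`, stub plan A1):
for column weights `a_k : Fin N → ℝ≥0` that are NESTED (`a_k ≤ a_l` pointwise for `l ≤ k`) and budgets
`β_k > 0`,

  `Haar{W ∈ U(N) : ∀ k, Σ_j a_k(j) |W_{jk}|² ≤ β_k}
     ≤ ∏_{k<N} 2^N · exp((Σ_{l<k} β_l)/β_k) · ∏_j (1 + a_k(j)/β_k)⁻¹`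

(`haar_measure_weightedPattern_le`).  Same column-by-column scheme as `haar_measure_nestedPattern_le`
(columns = Gram–Schmidt of Gaussian vectors, Fubini over the last vector), with the weighted conditional
bound `stdGaussian_measure_weightedColumn_le`: the nestedness makes the weighted mass of the previous
columns at most `Σ_{l<k} β_l`, which costs only the factor `exp((Σ_{l<k} β_l)/β_k)`.  All [folklore].
-/

noncomputable section

open MeasureTheory ProbabilityTheory Module Submodule InnerProductSpace
open Literature.Probability.Distributions Literature.Probability.RandomMatrix
open Literature.Analysis.InnerProduct
open Literature.MathematicalPhysics.QuantumFieldTheory (haarProbability)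
open scoped ENNReal InnerProductSpace

namespace Summit.QuantumFields.YangMills.Theorems.EguchiKawaiDirectionLadder.HaarColumns

variable {N : ℕ}

section Weighted

variable (a : ℕ → Fin N → ℝ) (β : ℕ → ℝ)

/-- The weighted column events are measurable. [folklore] -/
theorem measurableSet_weightedColEvent (q : ℕ) :
    MeasurableSet {f : Fin q → EuclideanSpace ℂ (Fin N) | ∀ k : Fin q,
      ∑ j, a k j * ‖(gramSchmidtNormed ℂ f k) j‖ ^ 2 ≤ β k} := by
  have h : {f : Fin q → EuclideanSpace ℂ (Fin N) | ∀ k : Fin q,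
      ∑ j, a k j * ‖(gramSchmidtNormed ℂ f k) j‖ ^ 2 ≤ β k} =
      ⋂ k : Fin q, {f : Fin q → EuclideanSpace ℂ (Fin N) |
        ∑ j, a k j * ‖(gramSchmidtNormed ℂ f k) j‖ ^ 2 ≤ β k} := by
    ext f; simp
  rw [h]
  refine MeasurableSet.iInter fun k => measurableSet_le ?_ measurable_const
  refine Finset.measurable_sum _ fun j _ => ?_
  exact ((((measurable_pi_apply j).comp ((measurable_ofLp_two (Fin N)).comp
    (measurable_gramSchmidtNormed_apply ℂ k))).norm).pow_const 2).const_mul _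

variable {a β}

/-- **The weighted conditional bound for one more column.** [folklore] -/
theorem stdGaussian_measure_newWeightedColumn_le (ha : ∀ k j, 0 ≤ a k j) (hβ : ∀ k, 0 < β k)
    (hnest : ∀ l k, l ≤ k → ∀ j, a k j ≤ a l j)
    {q : ℕ} {f : Fin q → EuclideanSpace ℂ (Fin N)} (hli : LinearIndependent ℂ f)
    (hf : f ∈ {f : Fin q → EuclideanSpace ℂ (Fin N) | ∀ k : Fin q,
      ∑ j, a k j * ‖(gramSchmidtNormed ℂ f k) j‖ ^ 2 ≤ β k}) :
    stdGaussian (EuclideanSpace ℂ (Fin N))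
        {g | ∑ j, a q j * ‖((span ℂ (Set.range f))ᗮ.starProjection g) j‖ ^ 2 ≤
          β q * ‖(span ℂ (Set.range f))ᗮ.starProjection g‖ ^ 2} ≤
      ENNReal.ofReal (2 ^ N * Real.exp ((∑ l ∈ Finset.range q, β l) / β q) *
        ∏ j, (1 + a q j / β q)⁻¹) := by
  -- the Gram–Schmidt basis of `K = span f`
  set e : Fin q → EuclideanSpace ℂ (Fin N) := gramSchmidtNormed ℂ f with he
  have hon : Orthonormal ℂ e := gramSchmidtNormed_orthonormal hli
  have hKf : span ℂ (Set.range f) = span ℂ (Set.range e) := by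
    rw [he, span_gramSchmidtNormed_range, span_gramSchmidt]
  rw [hKf]
  set K : Submodule ℂ (EuclideanSpace ℂ (Fin N)) := span ℂ (Set.range e) with hK
  let fK : Fin q → K := fun j => ⟨e j, subset_span (Set.mem_range_self j)⟩
  have hfK : Orthonormal ℂ fK := by
    have hon' := hon
    rw [orthonormal_iff_ite] at hon' ⊢
    intro i j
    rw [Submodule.coe_inner]
    exact hon' i j
  have hrange : Set.range fK = ((↑) : K → EuclideanSpace ℂ (Fin N)) ⁻¹' Set.range e := by
    ext x
    constructor
    · rintro ⟨j, rfl⟩; exact ⟨j, rfl⟩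
    · rintro ⟨j, hj⟩; exact ⟨j, Subtype.ext hj⟩
  let w : OrthonormalBasis (Fin q) ℂ K := OrthonormalBasis.mk hfK (by
    rw [hrange, Submodule.span_span_coe_preimage])
  have hw : ∀ l, (w l : EuclideanSpace ℂ (Fin N)) = e l := fun l => by simp [w, fK]
  -- the scaled weights
  have hβq := hβ q
  set a' : Fin N → ℝ := fun j => a q j / β q with ha'
  have ha'0 : ∀ j, 0 ≤ a' j := fun j => div_nonneg (ha q j) hβq.le
  -- the previous columns have small weighted mass
  have hσ : ∑ l, ∑ j, a' j * ‖(w l : EuclideanSpace ℂ (Fin N)) j‖ ^ 2 ≤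
      (∑ l ∈ Finset.range q, β l) / β q := by
    have h1 : ∀ l : Fin q, ∑ j, a' j * ‖(w l : EuclideanSpace ℂ (Fin N)) j‖ ^ 2 ≤ β l / β q := by
      intro l
      rw [hw]
      have h2 : ∑ j, a' j * ‖(e l) j‖ ^ 2 = (∑ j, a q j * ‖(e l) j‖ ^ 2) / β q := by
        rw [Finset.sum_div]
        refine Finset.sum_congr rfl fun j _ => ?_
        rw [ha']; ring
      rw [h2]
      refine div_le_div_of_nonneg_right ?_ hβq.le
      calc ∑ j, a q j * ‖(e l) j‖ ^ 2 ≤ ∑ j, a l j * ‖(e l) j‖ ^ 2 :=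
            Finset.sum_le_sum fun j _ => mul_le_mul_of_nonneg_right (hnest l q l.2.le j) (by positivity)
        _ ≤ β l := hf l
    calc ∑ l, ∑ j, a' j * ‖(w l : EuclideanSpace ℂ (Fin N)) j‖ ^ 2 ≤ ∑ l : Fin q, β l / β q :=
          Finset.sum_le_sum fun l _ => h1 l
      _ = (∑ l ∈ Finset.range q, β l) / β q := by
          rw [Finset.sum_div, Fin.sum_univ_eq_sum_range (fun l => β l / β q)]
  have h := stdGaussian_measure_weightedColumn_le K w a' ha'0 hσ
  -- the event in scaled form
  have hset : {g : EuclideanSpace ℂ (Fin N) | ∑ j, a q j * ‖(Kᗮ.starProjection g) j‖ ^ 2 ≤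
        β q * ‖Kᗮ.starProjection g‖ ^ 2} =
      {g | ∑ j, a' j * ‖(Kᗮ.starProjection g) j‖ ^ 2 ≤ ‖Kᗮ.starProjection g‖ ^ 2} := by
    ext g
    simp only [Set.mem_setOf_eq]
    have h2 : ∑ j, a' j * ‖(Kᗮ.starProjection g) j‖ ^ 2 =
        (∑ j, a q j * ‖(Kᗮ.starProjection g) j‖ ^ 2) / β q := by
      rw [Finset.sum_div]
      refine Finset.sum_congr rfl fun j _ => ?_
      rw [ha']; ring
    rw [h2, div_le_iff₀ hβq, mul_comm]
  rw [hset]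
  refine h.trans (le_of_eq ?_)
  rfl

/-- **Weighted column induction**: `γ^{⊗q}(event_q) ≤ ∏_{k<q} bound_k` for `q ≤ N`. [folklore] -/
theorem gaussianCols_weightedColEvent_le (ha : ∀ k j, 0 ≤ a k j) (hβ : ∀ k, 0 < β k)
    (hnest : ∀ l k, l ≤ k → ∀ j, a k j ≤ a l j) :
    ∀ q, q ≤ N → gaussianCols N q {f : Fin q → EuclideanSpace ℂ (Fin N) | ∀ k : Fin q,
      ∑ j, a k j * ‖(gramSchmidtNormed ℂ f k) j‖ ^ 2 ≤ β k} ≤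
      ∏ k ∈ Finset.range q, ENNReal.ofReal (2 ^ N * Real.exp ((∑ l ∈ Finset.range k, β l) / β k) *
        ∏ j, (1 + a k j / β k)⁻¹) := by
  intro q
  induction q with
  | zero =>
    intro _
    rw [Finset.prod_range_zero]
    exact prob_le_one
  | succ q ih =>
    intro hq
    have hqN : q < N := hq
    have IH := ih hqN.le
    set Vv := EuclideanSpace ℂ (Fin N) with hVv
    set γ : Measure Vv := stdGaussian Vv with hγ
    -- split off the last vector
    set eV := MeasurableEquiv.piFinSuccAbove (fun _ : Fin (q + 1) => Vv) (Fin.last q) with heV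
    have hmp : MeasurePreserving eV (gaussianCols N (q + 1)) (γ.prod (gaussianCols N q)) :=
      measurePreserving_piFinSuccAbove (fun _ : Fin (q + 1) => stdGaussian Vv) (Fin.last q)
    have heV_symm : ∀ p : Vv × (Fin q → Vv), eV.symm p = Fin.snoc p.2 p.1 := by
      intro p
      rw [heV, MeasurableEquiv.piFinSuccAbove_symm_apply, Fin.insertNthEquiv_last]
      rfl
    -- the residual of the new vector
    set R : Vv × (Fin q → Vv) → Vv :=
      fun p => gramSchmidt ℂ (Fin.snoc p.2 p.1 : Fin (q + 1) → Vv) (Fin.last q) with hR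
    have hRm : Measurable R :=
      (measurable_gramSchmidt_apply ℂ (Fin.last q)).comp (continuous_snoc q).measurable
    have hRK : ∀ (g : Vv) (f : Fin q → Vv),
        R (g, f) = (span ℂ (Set.range f))ᗮ.starProjection g := by
      intro g f
      rw [hR]
      dsimp only
      rw [gramSchmidt_last_eq_sub_starProjection, Fin.snoc_comp_castSucc, Fin.snoc_last,
        sub_starProjection_eq]
    -- the joint event
    set Aq : Set (Fin q → Vv) := {f : Fin q → EuclideanSpace ℂ (Fin N) | ∀ k : Fin q,
      ∑ j, a k j * ‖(gramSchmidtNormed ℂ f k) j‖ ^ 2 ≤ β k} with hAq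
    set bq : ℝ≥0∞ := ENNReal.ofReal (2 ^ N * Real.exp ((∑ l ∈ Finset.range q, β l) / β q) *
        ∏ j, (1 + a q j / β q)⁻¹) with hbq
    set J : Set (Vv × (Fin q → Vv)) := {p | p.2 ∈ Aq} ∩
      {p | ∑ j, a q j * ‖(R p) j‖ ^ 2 ≤ β q * ‖R p‖ ^ 2} with hJ
    have hJm : MeasurableSet J := by
      refine (measurable_snd (measurableSet_weightedColEvent a β q)).inter (measurableSet_le ?_ ?_)
      · refine Finset.measurable_sum _ fun j _ => ?_
        exact ((((measurable_pi_apply j).comp ((measurable_ofLp_two (Fin N)).comp hRm)).norm).pow_const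
          2).const_mul _
      · exact (hRm.norm.pow_const 2).const_mul _
    have hsub : eV.symm ⁻¹' {f : Fin (q + 1) → EuclideanSpace ℂ (Fin N) | ∀ k : Fin (q + 1),
      ∑ j, a k j * ‖(gramSchmidtNormed ℂ f k) j‖ ^ 2 ≤ β k} ⊆ J := by
      intro p hp
      rw [Set.mem_preimage, heV_symm] at hp
      refine ⟨fun k => ?_, ?_⟩
      · have h := hp (Fin.castSucc k)
        rw [← gramSchmidtNormed_comp_castSucc ℂ (Fin.snoc p.2 p.1 : Fin (q + 1) → Vv) k,
          Fin.snoc_comp_castSucc] at h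
        simp only [Fin.val_castSucc] at h
        exact h
      · have h := hp (Fin.last q)
        simp only [Fin.val_last] at h
        unfold gramSchmidtNormed at h
        have hcoord : ∀ j, ‖(((‖R p‖ : ℂ))⁻¹ • R p) j‖ ^ 2 = (‖R p‖ ^ 2)⁻¹ * ‖(R p) j‖ ^ 2 := by
          intro j
          rw [PiLp.smul_apply, norm_smul, norm_inv, mul_pow, inv_pow]
          have hn : ‖((‖R p‖ : ℝ) : ℂ)‖ = ‖R p‖ := by
            rw [Complex.norm_real, Real.norm_eq_abs, abs_norm]
          rw [hn]
        change ∑ j, a q j * ‖(((‖R p‖ : ℂ))⁻¹ • R p) j‖ ^ 2 ≤ β q at h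
        simp only [hcoord] at h
        have h' : (‖R p‖ ^ 2)⁻¹ * ∑ j, a q j * ‖(R p) j‖ ^ 2 ≤ β q := by
          rw [Finset.mul_sum]
          refine le_trans (le_of_eq (Finset.sum_congr rfl fun j _ => ?_)) h
          ring
        show ∑ j, a q j * ‖(R p) j‖ ^ 2 ≤ β q * ‖R p‖ ^ 2
        by_cases h0 : ‖R p‖ = 0
        · have : R p = 0 := norm_eq_zero.1 h0
          rw [this]
          simp only [PiLp.zero_apply, norm_zero, ne_eq, OfNat.ofNat_ne_zero, not_false_eq_true,
            zero_pow, mul_zero, Finset.sum_const_zero]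
          exact le_refl _
        · have hpos : 0 < ‖R p‖ ^ 2 := by positivity
          have := mul_le_mul_of_nonneg_right h' hpos.le
          rwa [mul_comm, ← mul_assoc, mul_inv_cancel₀ hpos.ne', one_mul] at this
    -- the conditional bound, almost everywhere in the previous columns
    have hae : ∀ᵐ f ∂(gaussianCols N q), γ ((fun g : Vv => (g, f)) ⁻¹' J) ≤ Aq.indicator (fun _ => bq) f := by
      filter_upwards [ae_linearIndependent_gaussianCols (m := N) hqN.le] with f hli
      by_cases hf : f ∈ Aq
      · rw [Set.indicator_of_mem hf]
        have hset : (fun g : Vv => (g, f)) ⁻¹' J =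
            {g | ∑ j, a q j * ‖((span ℂ (Set.range f))ᗮ.starProjection g) j‖ ^ 2 ≤
              β q * ‖(span ℂ (Set.range f))ᗮ.starProjection g‖ ^ 2} := by
          ext g
          simp only [hJ, Set.mem_preimage, Set.mem_inter_iff, Set.mem_setOf_eq, hRK g f]
          exact ⟨fun h => h.2, fun h => ⟨hf, h⟩⟩
        rw [hset]
        exact stdGaussian_measure_newWeightedColumn_le ha hβ hnest hli hf
      · rw [Set.indicator_of_notMem hf]
        have hset : (fun g : Vv => (g, f)) ⁻¹' J = ∅ := by
          ext g
          simp only [hJ, Set.mem_preimage, Set.mem_inter_iff, Set.mem_setOf_eq, Set.mem_empty_iff_false,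
            iff_false, not_and]
          exact fun h _ => hf h
        rw [hset, measure_empty]
    calc gaussianCols N (q + 1) {f : Fin (q + 1) → EuclideanSpace ℂ (Fin N) | ∀ k : Fin (q + 1),
          ∑ j, a k j * ‖(gramSchmidtNormed ℂ f k) j‖ ^ 2 ≤ β k}
        = (γ.prod (gaussianCols N q)) (eV.symm ⁻¹' {f : Fin (q + 1) → EuclideanSpace ℂ (Fin N) |
            ∀ k : Fin (q + 1), ∑ j, a k j * ‖(gramSchmidtNormed ℂ f k) j‖ ^ 2 ≤ β k}) :=
          (hmp.symm.measure_preimage_equiv _).symm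
      _ ≤ (γ.prod (gaussianCols N q)) J := measure_mono hsub
      _ = ∫⁻ f, γ ((fun g : Vv => (g, f)) ⁻¹' J) ∂(gaussianCols N q) := Measure.prod_apply_symm hJm
      _ ≤ ∫⁻ f, Aq.indicator (fun _ => bq) f ∂(gaussianCols N q) := lintegral_mono_ae hae
      _ = bq * gaussianCols N q Aq := lintegral_indicator_const (measurableSet_weightedColEvent a β q) _
      _ ≤ bq * ∏ k ∈ Finset.range q, ENNReal.ofReal (2 ^ N * Real.exp ((∑ l ∈ Finset.range k, β l) / β k) *
            ∏ j, (1 + a k j / β k)⁻¹) := by gcongr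
      _ = ∏ k ∈ Finset.range (q + 1), ENNReal.ofReal (2 ^ N *
            Real.exp ((∑ l ∈ Finset.range k, β l) / β k) * ∏ j, (1 + a k j / β k)⁻¹) := by
          rw [Finset.prod_range_succ, mul_comm]

/-- **Weighted nested-pattern small-ball bound for Haar unitaries.** For nested column weights
`a_k ≥ 0` (`a_k ≤ a_l` pointwise for `l ≤ k`) and budgets `β_k > 0`,
`Haar{W : ∀ k, Σ_j a_k(j)|W_{jk}|² ≤ β_k} ≤ ∏_{k<N} 2^N exp((Σ_{l<k}β_l)/β_k) ∏_j (1 + a_k(j)/β_k)⁻¹`.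
[folklore] -/
theorem haar_measure_weightedPattern_le (a : ℕ → Fin N → ℝ) (β : ℕ → ℝ) (ha : ∀ k j, 0 ≤ a k j)
    (hβ : ∀ k, 0 < β k) (hnest : ∀ l k, l ≤ k → ∀ j, a k j ≤ a l j) :
    haarProbability (Matrix.unitaryGroup (Fin N) ℂ)
        {W | ∀ k : Fin N, ∑ j, a k j * ‖(W : Matrix (Fin N) (Fin N) ℂ) j k‖ ^ 2 ≤ β k} ≤
      ∏ k ∈ Finset.range N, ENNReal.ofReal (2 ^ N * Real.exp ((∑ l ∈ Finset.range k, β l) / β k) *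
        ∏ j, (1 + a k j / β k)⁻¹) := by
  set D : Set (Fin N → EuclideanSpace ℂ (Fin N)) :=
    {u | ∀ k : Fin N, ∑ j, a k j * ‖u k j‖ ^ 2 ≤ β k} with hD
  have hDm : MeasurableSet D := by
    have h : D = ⋂ k : Fin N, {u : Fin N → EuclideanSpace ℂ (Fin N) | ∑ j, a k j * ‖u k j‖ ^ 2 ≤ β k} := by
      ext u; simp [hD]
    rw [h]
    refine MeasurableSet.iInter fun k => measurableSet_le ?_ measurable_const
    refine Finset.measurable_sum _ fun j _ => ?_
    exact ((((measurable_pi_apply j).comp ((measurable_ofLp_two (Fin N)).comp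
      (measurable_pi_apply k))).norm).pow_const 2).const_mul _
  have hpre : {W : Matrix.unitaryGroup (Fin N) ℂ |
      ∀ k : Fin N, ∑ j, a k j * ‖(W : Matrix (Fin N) (Fin N) ℂ) j k‖ ^ 2 ≤ β k} =
      firstCols N N le_rfl ⁻¹' D := by
    ext W
    simp only [Set.mem_setOf_eq, Set.mem_preimage, hD, firstCols_apply, Fin.castLE_rfl, id_eq]
  have hGSN : gramSchmidtNormed ℂ ⁻¹' D = {f : Fin N → EuclideanSpace ℂ (Fin N) | ∀ k : Fin N,
      ∑ j, a k j * ‖(gramSchmidtNormed ℂ f k) j‖ ^ 2 ≤ β k} := by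
    ext f; simp only [Set.mem_preimage, hD, Set.mem_setOf_eq]
  rw [hpre, ← Measure.map_apply (continuous_firstCols N le_rfl).measurable hDm,
    map_firstCols_haar_eq_map_gramSchmidtNormed le_rfl,
    Measure.map_apply (measurable_gramSchmidtNormed ℂ) hDm, hGSN]
  exact gaussianCols_weightedColEvent_le ha hβ hnest N le_rfl

end Weighted

end Summit.QuantumFields.YangMills.Theorems.EguchiKawaiDirectionLadder.HaarColumns

end
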